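/-
Copyright (c) 2026 the pub-hodgecm-mathlib formalisation cell (harness21).  Prover seat hodgecm-mathlib-K2Liu-p08 (g2), Track B «K2-LIT»,
#184♮ = hLiu418 = `stmt-HodgeConjecture-24832`; LEAD F0P6-plan (g13) RULINGS «M-157c» (1) 2026-09-04T08:38:55Z and «M-157h» (ONE LETTER OF RECORD)
2026-09-04T08:47:41Z; K2Liu-p12 (g0) SPEC `K2/K2Liu-p12/g0/SPEC-PHI5-F3-LeviSupplyAndCovering.K2Liu-p12-g0.md` §F3b.  Road Φ of socket #41, organ Φ5, file F3b.
-/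
import Summits.HodgeConjecture.HodgeConjecture.Theorems.K2LiuUnipDeltaConjugationModulus   -- ★ `continuous_nElem_skew`, ★ `isClosed_skew` (via imports)
import Summits.HodgeConjecture.HodgeConjecture.Theorems.K2LiuLocalRingValuationBalls       -- ★ F3c-1 THE LETTER: `valued_toPlace_uniformizer_*`, `mball_*`, `ball_zero`
import Literature.NumberTheory.Automorphic.TateLocalZetaShells                            -- ★ `isCompact/isOpen_primePowBall`
import Literature.NumberTheory.Automorphic.AddCharConductorExponent                       -- ★ `mem_primePowBall_adicCompletion_iff`
import Literature.NumberTheory.Automorphic.AdicCompletionLocalField                       -- ★ `E_w` is a non-archimedean local field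
import HarnessLib

/-!
# Crux `HLiu418`, Road Φ, organ Φ5 — FILE F3b: THE LATTICE MODEL OF `Skew ≅ N_Δ(F_v)` — BALLS, SHELLS, LEVI PRESERVATION, REGULARITY OF THE PULL-BACK

Cell `hodgecm-mathlib`, crux item hLiu418 = `stmt-HodgeConjecture-24832`; LEAD F0P6-plan (g13) (M-157c (1), M-157h), co-dealer K2E5-plan (g6), organ owner
K2Liu-p12 (g0) (★ F1 `K2LiuShellVanishingByAveraging`, ★ F2 `K2LiuShellStabilization`, ★ F3a `K2LiuLocalLeviSupply`, ★ F3c-1 `K2LiuLocalRingValuationBalls`,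
★ F4a `K2LiuBadPlaceWhittakerShells`).  THEOREMS ONLY (no `def`, no instance, no notation, no named-fact hypothesis, no `sorry`); lane
`--supports stmt-HodgeConjecture-24832 --as helper` (count-neutral).  Consumers: F3c-2 `K2LiuWhittakerCharacterMoves`, F4b `K2LiuBadPlaceWhittakerHeads` (p12).

CARRIERS (★ D10 local frame, as in ★ F4a): `R := LocalRing E v = Π_{w ∣ v} E_w`, `S : AddSubgroup (Matrix (Fin n) (Fin n) R)` with
`hS : ∀ t, t ∈ S ↔ σ(t)ᵀ T + T t = 0` (`σ = conjLocal`, `T = gramS F E v n T₀`), the pulled-back section `t ↦ f(w_Δ n(t))` (★ `weylDelta`, ★ `nElem`).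

THE LETTER (M-157h, the ONE letter of record = ★ F3c-1, per coordinate `w ∣ v` the threshold `v_w(ϖ_w)^a`, `ϖ_w = ι_w π` for a FIXED uniformizer `π` of `F_v`,
frame `{π : v.adicCompletion F} (hπ : Valued.v π = WithZero.exp (-1 : ℤ))`):
  `B a := {t : S | ∀ i j (w : PlacesOver E v), Valued.v (t.1 i j w) ≤ Valued.v (toPlace v w π) ^ a}`,   `Sh k := B (−k) \ B (−k + 1)`
(written out everywhere; no definition).  The algebra of this letter (antitone, `+`, `Σ`, products `a + b`, scalars `ẑ •` for `z ∈ 𝔭_v^j ↦ j + a`, `1 ∈ ball 0`) is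
★ F3c-1 (`ball_*`, `mball_*`) and is CITED, not restated.
* §0 BRIDGE: `exists_setOf_valued_le_eq_primePowBall` — each coordinate condition `{x : E_w | v_w x ≤ v_w(ϖ_w)^a}` IS a ball `𝔭_w^m = primePowBall E_w m` of the tree
  (★ `mem_primePowBall_adicCompletion_iff`, `m = −a · log v_w(ϖ_w)`), so the tree's topology of `𝔭_w^m` (★ `isOpen∕isCompact_primePowBall`) ports; two `ℤₘ₀` one-liners
  `exists_le_zpow_of_le_exp_neg_one` (`∃ a, x ≤ γ^a`) and `eq_zero_of_forall_le_zpow` (`(∀ a, x ≤ γ^a) ⇒ x = 0`) for a threshold `0 ≠ γ ≤ exp(−1)`.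
* §1 BALLS: `ball_eq_preimage`, `ball_antitone` (set form of ★ `mball_antitone`), `zero_mem_ball`; `isOpen_ball`, `isCompact_ball` (`S` is closed, ★ `isClosed_skew`; Tychonoff over
  `(i, j, w)`), `isClosed_ball`, `measurableSet_ball`; `exists_mem_ball` (`⋃_a B a = S`), `eq_zero_of_forall_mem_ball` (`⋂_a B a = 0`); `measure_ball_pos_lt_top`,
  `measure_ball_ne_zero`, `measure_ball_ne_top` (= F4a's `hΛ₀0`, `hΛ₀`; additive Haar measure).
* §2 SHELLS: `shell_subset_ball`, `measurableSet_shell` (= F4a's `hShm`), `measure_shell_lt_top`, `measure_shell_ne_top` (= `hShμ`).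
* §3 LEVI PRESERVATION (= F4a's `hLΛ₀`, `hLSh`): **`preimage_ball_eq_of_integral`**, **`preimage_shell_eq_of_integral`** — a bi-continuous additive automorphism `L` of `S`
  with `(L t) = A t D′`, `(L⁻¹ t) = A′ t D″`, all four INTEGRAL (entries in the ball of exponent `0`), fixes every ball (★ `mball_mul` twice, `0 + a + 0`) and every shell.
* §4 REGULARITY (= F4a's `hφm`, `hφC`): `continuous_of_rightInvariant` (right-invariance under an OPEN subgroup ⇒ locally constant ⇒ continuous),
  **`continuous_pullback`** (★ `continuous_nElem_skew`), `measurable_pullback`, `exists_bound_pullback_of_isCompact` ∕ `exists_bound_pullback_shell`.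
[Casselman1980, §3] [KudlaRallis1994, §2] [Shimura1997, §18] [BushnellHenniart2006, §1.1] [CasselsFrohlichANT1967, Ch. II §10].
HONEST LABEL.  Count-neutral helper; `HC_CM` is proved only modulo the 7 printed citations (2 remaining named inputs: hLiu418 = `stmt-HodgeConjecture-24832`,
h413 = `stmt-HodgeConjecture-24833`) until rung 0 closes.
-/

set_option autoImplicit false
-- the mandated namespace repeats the single-problem summit's segment (`HodgeConjecture.HodgeConjecture`)
set_option linter.dupNamespace false

noncomputable section

open scoped NNReal ENNReal Topology Pointwise
open NumberField IsDedekindDomain Matrix MeasureTheory Set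
open Literature.NumberTheory.GaloisRepresentations.IsNonarchimedeanLocalField
open Literature.NumberTheory.Automorphic Literature.NumberTheory.Automorphic.UnitaryGroup
open Literature.NumberTheory.GelbartRogawski1991.AdaptedBlocks
open Literature.NumberTheory.GelbartRogawski1991.UnitaryDualPair.LocalSplitting
open Literature.NumberTheory.K2Lit.LocalSiegelDoubled
open Summit.HodgeConjecture.HodgeConjecture.Cruxes.HLiu418.K2LiuUnipDeltaConjugationModulus
open Summit.HodgeConjecture.HodgeConjecture.Cruxes.HLiu418.K2LiuSkewConjugationHaarChar (isClosed_skew)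
open Summit.HodgeConjecture.HodgeConjecture.Cruxes.HLiu418.K2LiuLocalRingValuationBalls

namespace Summit.HodgeConjecture.HodgeConjecture.Cruxes.HLiu418.K2LiuSkewLatticeShells

variable (F : Type) [Field F] [NumberField F] (E : Type) [Field E] [NumberField E] [Algebra F E] (c : E ≃ₐ[F] E)
  (v : HeightOneSpectrum (𝓞 F)) {π : v.adicCompletion F} (hπ : Valued.v π = WithZero.exp (-1 : ℤ))
  (n : ℕ) {T₀ : Matrix (Fin n) (Fin n) F}
  {JD : Matrix (Fin (n + n)) (Fin (n + n)) E} (hJD : JD = (gramD F n T₀).map (algebraMap F E))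
  (S : AddSubgroup (Matrix (Fin n) (Fin n) (LocalRing E v)))
  (hS : ∀ t, t ∈ S ↔ (t.map (conjLocal E c v))ᵀ * gramS F E v n T₀ + gramS F E v n T₀ * t = 0)

/-! ## §0 The bridge to the tree's balls `𝔭_w^m`, and two `ℤₘ₀` one-liners -/

section Bridge

/-- **`∃ a, x ≤ γ^a`** for a threshold `0 ≠ γ ≤ exp(−1)` of `ℤₘ₀` (take `a = −|log x|`: `γ^{−|k|} ≥ exp |k| ≥ exp k`). [cite: CasselsFrohlichANT1967, Ch. II §10] -/
theorem exists_le_zpow_of_le_exp_neg_one {γ : WithZero (Multiplicative ℤ)} (h0 : γ ≠ 0) (h1 : γ ≤ WithZero.exp (-1 : ℤ))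
    (x : WithZero (Multiplicative ℤ)) : ∃ a : ℤ, x ≤ γ ^ a := by
  by_cases hx : x = 0
  · exact ⟨0, hx ▸ zero_le⟩
  have hγ : WithZero.log γ ≤ -1 := by rwa [← WithZero.exp_le_exp, WithZero.exp_log h0]
  refine ⟨-|WithZero.log x|, ?_⟩
  rw [← WithZero.exp_log hx, ← WithZero.exp_log h0, ← WithZero.exp_zsmul, WithZero.exp_le_exp, smul_eq_mul, WithZero.log_exp]
  nlinarith [abs_nonneg (WithZero.log x), le_abs_self (WithZero.log x)]

/-- **`(∀ a, x ≤ γ^a) ⇒ x = 0`** for a threshold `0 ≠ γ ≤ exp(−1)` (at `a = |log x| + 1`, `γ^a ≤ exp(−a) < x`). [cite: CasselsFrohlichANT1967, Ch. II §10] -/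
theorem eq_zero_of_forall_le_zpow {γ : WithZero (Multiplicative ℤ)} (h0 : γ ≠ 0) (h1 : γ ≤ WithZero.exp (-1 : ℤ))
    {x : WithZero (Multiplicative ℤ)} (h : ∀ a : ℤ, x ≤ γ ^ a) : x = 0 := by
  by_contra hx
  have hγ : WithZero.log γ ≤ -1 := by rwa [← WithZero.exp_le_exp, WithZero.exp_log h0]
  have ha := h (|WithZero.log x| + 1)
  rw [← WithZero.exp_log hx, ← WithZero.exp_log h0, ← WithZero.exp_zsmul, WithZero.exp_le_exp, smul_eq_mul, WithZero.log_exp] at ha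
  nlinarith [abs_nonneg (WithZero.log x), neg_abs_le (WithZero.log x)]

include hπ in
/-- **THE BRIDGE (M-157h)**: the coordinate condition `v_w x ≤ v_w(ϖ_w)^a` cuts out a ball `𝔭_w^m` of the tree (`m = −a · log v_w(ϖ_w)`;
★ `mem_primePowBall_adicCompletion_iff`, ★ `valued_toPlace_uniformizer_ne_zero`). [cite: CasselsFrohlichANT1967, Ch. II §10] -/
theorem exists_setOf_valued_le_eq_primePowBall (a : ℤ) (w : PlacesOver E v) :
    ∃ m : ℤ, {x : w.1.adicCompletion E | Valued.v x ≤ Valued.v (toPlace v w π) ^ a} = primePowBall (w.1.adicCompletion E) m := by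
  refine ⟨-(a • WithZero.log (Valued.v (toPlace v w π))), Set.ext fun x => ?_⟩
  rw [Set.mem_setOf_eq, mem_primePowBall_adicCompletion_iff, neg_neg, WithZero.exp_zsmul,
    WithZero.exp_log (valued_toPlace_uniformizer_ne_zero F E v hπ w)]

include hπ in
/-- the coordinate condition is OPEN (★ `isOpen_primePowBall` through the bridge). [cite: BushnellHenniart2006, §1.1] -/
theorem isOpen_setOf_valued_le (a : ℤ) (w : PlacesOver E v) : IsOpen {x : w.1.adicCompletion E | Valued.v x ≤ Valued.v (toPlace v w π) ^ a} := by
  obtain ⟨m, hm⟩ := exists_setOf_valued_le_eq_primePowBall F E v hπ a w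
  rw [hm]; exact isOpen_primePowBall m

include hπ in
/-- the coordinate condition is COMPACT (★ `isCompact_primePowBall` through the bridge). [cite: BushnellHenniart2006, §1.1] -/
theorem isCompact_setOf_valued_le (a : ℤ) (w : PlacesOver E v) : IsCompact {x : w.1.adicCompletion E | Valued.v x ≤ Valued.v (toPlace v w π) ^ a} := by
  obtain ⟨m, hm⟩ := exists_setOf_valued_le_eq_primePowBall F E v hπ a w
  rw [hm]; exact isCompact_primePowBall m

end Bridge

/-! ## §1 The balls `B a` -/

section Balls

/-- the ball `B a` is the trace on `S` of the product of the coordinate conditions. [folklore] -/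
theorem ball_eq_preimage (a : ℤ) :
    {t : S | ∀ i j (w : PlacesOver E v), Valued.v (t.1 i j w) ≤ Valued.v (toPlace v w π) ^ a} =
      Subtype.val ⁻¹' Set.univ.pi fun _ : Fin n => Set.univ.pi fun _ : Fin n =>
        Set.univ.pi fun w : PlacesOver E v => {x : w.1.adicCompletion E | Valued.v x ≤ Valued.v (toPlace v w π) ^ a} := by
  ext t
  exact ⟨fun h i _ j _ w _ => h i j w, fun h i j w => h i (Set.mem_univ _) j (Set.mem_univ _) w (Set.mem_univ _)⟩

include hπ in
/-- **the balls decrease in `a`**: `B a' ⊆ B a` for `a ≤ a'` (set form of ★ `mball_antitone`). [cite: BushnellHenniart2006, §1.1] -/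
theorem ball_antitone {a a' : ℤ} (h : a ≤ a') :
    {t : S | ∀ i j (w : PlacesOver E v), Valued.v (t.1 i j w) ≤ Valued.v (toPlace v w π) ^ a'} ⊆
      {t : S | ∀ i j (w : PlacesOver E v), Valued.v (t.1 i j w) ≤ Valued.v (toPlace v w π) ^ a} :=
  fun _ ht => mball_antitone F E v hπ h ht

/-- `0 ∈ B a` (★ `ball_zero`). [cite: BushnellHenniart2006, §1.1] -/
theorem zero_mem_ball (a : ℤ) :
    (0 : S) ∈ {t : S | ∀ i j (w : PlacesOver E v), Valued.v (t.1 i j w) ≤ Valued.v (toPlace v w π) ^ a} :=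
  fun _ _ => ball_zero F E v a

include hπ in
/-- **`B a` is open** (finitely many open coordinate conditions). [cite: BushnellHenniart2006, §1.1] -/
theorem isOpen_ball (a : ℤ) : IsOpen {t : S | ∀ i j (w : PlacesOver E v), Valued.v (t.1 i j w) ≤ Valued.v (toPlace v w π) ^ a} := by
  rw [ball_eq_preimage]
  exact (isOpen_set_pi Set.finite_univ fun i _ => isOpen_set_pi Set.finite_univ fun j _ =>
    isOpen_set_pi Set.finite_univ fun w _ => isOpen_setOf_valued_le F E v hπ a w).preimage continuous_subtype_val

include c hS hπ in
/-- **`B a` is compact**: `S` is closed in `M_n(E ⊗ F_v)` (★ `isClosed_skew`) and the product of the compact coordinate conditions is compact (Tychonoff).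
[cite: BushnellHenniart2006, §1.1] -/
theorem isCompact_ball (a : ℤ) : IsCompact {t : S | ∀ i j (w : PlacesOver E v), Valued.v (t.1 i j w) ≤ Valued.v (toPlace v w π) ^ a} := by
  rw [ball_eq_preimage]
  have hK : IsCompact (Set.univ.pi fun _ : Fin n => Set.univ.pi fun _ : Fin n =>
      Set.univ.pi fun w : PlacesOver E v => {x : w.1.adicCompletion E | Valued.v x ≤ Valued.v (toPlace v w π) ^ a}) :=
    isCompact_univ_pi fun _ => isCompact_univ_pi fun _ => isCompact_univ_pi fun w => isCompact_setOf_valued_le F E v hπ a w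
  exact (isClosed_skew F E c v n S hS).isClosedEmbedding_subtypeVal.isCompact_preimage hK

include c hS hπ in
/-- `B a` is closed. [cite: BushnellHenniart2006, §1.1] -/
theorem isClosed_ball (a : ℤ) : IsClosed {t : S | ∀ i j (w : PlacesOver E v), Valued.v (t.1 i j w) ≤ Valued.v (toPlace v w π) ^ a} :=
  (isCompact_ball F E c v hπ n S hS a).isClosed

include hπ in
/-- `B a` is measurable (it is open). [folklore] -/
theorem measurableSet_ball [MeasurableSpace S] [BorelSpace S] (a : ℤ) :
    MeasurableSet {t : S | ∀ i j (w : PlacesOver E v), Valued.v (t.1 i j w) ≤ Valued.v (toPlace v w π) ^ a} :=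
  (isOpen_ball F E v hπ n S a).measurableSet

include hπ in
/-- **`⋃_a B a = S`**: every `t` lies in some ball (finitely many entries, `exists_le_zpow_of_le_exp_neg_one`, and the balls decrease). [cite: BushnellHenniart2006, §1.1] -/
theorem exists_mem_ball (t : S) :
    ∃ a : ℤ, t ∈ {t : S | ∀ i j (w : PlacesOver E v), Valued.v (t.1 i j w) ≤ Valued.v (toPlace v w π) ^ a} := by
  choose m hm using fun ijw : Fin n × Fin n × PlacesOver E v =>
    exists_le_zpow_of_le_exp_neg_one (valued_toPlace_uniformizer_ne_zero F E v hπ ijw.2.2) (valued_toPlace_uniformizer_le F E v hπ ijw.2.2)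
      (Valued.v (t.1 ijw.1 ijw.2.1 ijw.2.2))
  obtain ⟨a, ha⟩ := Finite.bddBelow_range m
  exact ⟨a, fun i j w => (hm (i, j, w)).trans (zpow_le_zpow_right_of_le_one₀ (zero_lt_iff.2 (valued_toPlace_uniformizer_ne_zero F E v hπ w))
    (valued_toPlace_uniformizer_le_one F E v hπ w) (ha ⟨(i, j, w), rfl⟩))⟩

include hπ in
/-- **`⋂_a B a = {0}`** (`eq_zero_of_forall_le_zpow` entrywise). [cite: BushnellHenniart2006, §1.1] -/
theorem eq_zero_of_forall_mem_ball {t : S}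
    (ht : ∀ a : ℤ, t ∈ {t : S | ∀ i j (w : PlacesOver E v), Valued.v (t.1 i j w) ≤ Valued.v (toPlace v w π) ^ a}) : t = 0 := by
  refine Subtype.ext (Matrix.ext fun i j => funext fun w => ?_)
  exact (Valuation.zero_iff _).1 (eq_zero_of_forall_le_zpow (valued_toPlace_uniformizer_ne_zero F E v hπ w)
    (valued_toPlace_uniformizer_le F E v hπ w) fun a => ht a i j w)

include c hS hπ in
/-- **`0 < μ(B a) < ∞`** for an additive Haar measure `μ` on `S` (open and nonempty; compact). [folklore] -/
theorem measure_ball_pos_lt_top [MeasurableSpace S] [BorelSpace S] (μ : Measure S) [μ.IsAddHaarMeasure] (a : ℤ) :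
    0 < μ {t : S | ∀ i j (w : PlacesOver E v), Valued.v (t.1 i j w) ≤ Valued.v (toPlace v w π) ^ a} ∧
      μ {t : S | ∀ i j (w : PlacesOver E v), Valued.v (t.1 i j w) ≤ Valued.v (toPlace v w π) ^ a} < ∞ :=
  ⟨(isOpen_ball F E v hπ n S a).measure_pos μ ⟨0, zero_mem_ball F E v n S a⟩, (isCompact_ball F E c v hπ n S hS a).measure_lt_top⟩

include c hS hπ in
/-- `μ(B a) ≠ 0` (= F4a's `hΛ₀0` for `Λ₀ = B a`). [folklore] -/
theorem measure_ball_ne_zero [MeasurableSpace S] [BorelSpace S] (μ : Measure S) [μ.IsAddHaarMeasure] (a : ℤ) :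
    μ {t : S | ∀ i j (w : PlacesOver E v), Valued.v (t.1 i j w) ≤ Valued.v (toPlace v w π) ^ a} ≠ 0 :=
  (measure_ball_pos_lt_top F E c v hπ n S hS μ a).1.ne'

include c hS hπ in
/-- `μ(B a) ≠ ∞` (= F4a's `hΛ₀` for `Λ₀ = B a`). [folklore] -/
theorem measure_ball_ne_top [MeasurableSpace S] [BorelSpace S] (μ : Measure S) [μ.IsAddHaarMeasure] (a : ℤ) :
    μ {t : S | ∀ i j (w : PlacesOver E v), Valued.v (t.1 i j w) ≤ Valued.v (toPlace v w π) ^ a} ≠ ∞ :=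
  (measure_ball_pos_lt_top F E c v hπ n S hS μ a).2.ne

end Balls

/-! ## §2 The shells `Sh k = B(−k) ∖ B(−k+1)` -/

section Shells

/-- a shell lies in the outer ball. [folklore] -/
theorem shell_subset_ball (k : ℤ) :
    {t : S | ∀ i j (w : PlacesOver E v), Valued.v (t.1 i j w) ≤ Valued.v (toPlace v w π) ^ (-k)} \
        {t : S | ∀ i j (w : PlacesOver E v), Valued.v (t.1 i j w) ≤ Valued.v (toPlace v w π) ^ (-k + 1)} ⊆
      {t : S | ∀ i j (w : PlacesOver E v), Valued.v (t.1 i j w) ≤ Valued.v (toPlace v w π) ^ (-k)} :=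
  Set.sdiff_subset

include hπ in
/-- shells are measurable (= F4a's `hShm`). [folklore] -/
theorem measurableSet_shell [MeasurableSpace S] [BorelSpace S] (k : ℤ) :
    MeasurableSet ({t : S | ∀ i j (w : PlacesOver E v), Valued.v (t.1 i j w) ≤ Valued.v (toPlace v w π) ^ (-k)} \
      {t : S | ∀ i j (w : PlacesOver E v), Valued.v (t.1 i j w) ≤ Valued.v (toPlace v w π) ^ (-k + 1)}) :=
  (measurableSet_ball F E v hπ n S (-k)).diff (measurableSet_ball F E v hπ n S (-k + 1))

include c hS hπ in
/-- shells have finite Haar measure. [folklore] -/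
theorem measure_shell_lt_top [MeasurableSpace S] [BorelSpace S] (μ : Measure S) [μ.IsAddHaarMeasure] (k : ℤ) :
    μ ({t : S | ∀ i j (w : PlacesOver E v), Valued.v (t.1 i j w) ≤ Valued.v (toPlace v w π) ^ (-k)} \
      {t : S | ∀ i j (w : PlacesOver E v), Valued.v (t.1 i j w) ≤ Valued.v (toPlace v w π) ^ (-k + 1)}) < ∞ :=
  lt_of_le_of_lt (measure_mono Set.sdiff_subset) (measure_ball_pos_lt_top F E c v hπ n S hS μ (-k)).2

include c hS hπ in
/-- `μ(Sh k) ≠ ∞` (= F4a's `hShμ`). [folklore] -/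
theorem measure_shell_ne_top [MeasurableSpace S] [BorelSpace S] (μ : Measure S) [μ.IsAddHaarMeasure] (k : ℤ) :
    μ ({t : S | ∀ i j (w : PlacesOver E v), Valued.v (t.1 i j w) ≤ Valued.v (toPlace v w π) ^ (-k)} \
      {t : S | ∀ i j (w : PlacesOver E v), Valued.v (t.1 i j w) ≤ Valued.v (toPlace v w π) ^ (-k + 1)}) ≠ ∞ :=
  (measure_shell_lt_top F E c v hπ n S hS μ k).ne

end Shells

/-! ## §3 Levi preservation: integral conjugations fix every ball and every shell -/

section Levi

include hπ in
/-- **LEVI PRESERVATION OF THE BALLS (= F4a's `hLΛ₀`)**: a bi-continuous additive automorphism `L` of `S` acting by `t ↦ A t D′` with inverse `t ↦ A′ t D″`,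
all four matrices INTEGRAL (ball of exponent `0`), satisfies `L ⁻¹' B a = B a` for every `a` (★ `mball_mul` twice: exponent `0 + a + 0`).
[cite: HarrisKudlaSweet1996, §1 (1.12)] [cite: Casselman1980, §3] -/
theorem preimage_ball_eq_of_integral (L : S ≃ₜ+ S) {A D' A' D'' : Matrix (Fin n) (Fin n) (LocalRing E v)}
    (hL : ∀ t : S, (L t).1 = A * t.1 * D') (hL' : ∀ t : S, (L.symm t).1 = A' * t.1 * D'')
    (hA : ∀ i j (w : PlacesOver E v), Valued.v (A i j w) ≤ Valued.v (toPlace v w π) ^ (0 : ℤ))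
    (hD' : ∀ i j (w : PlacesOver E v), Valued.v (D' i j w) ≤ Valued.v (toPlace v w π) ^ (0 : ℤ))
    (hA' : ∀ i j (w : PlacesOver E v), Valued.v (A' i j w) ≤ Valued.v (toPlace v w π) ^ (0 : ℤ))
    (hD'' : ∀ i j (w : PlacesOver E v), Valued.v (D'' i j w) ≤ Valued.v (toPlace v w π) ^ (0 : ℤ)) (a : ℤ) :
    L ⁻¹' {t : S | ∀ i j (w : PlacesOver E v), Valued.v (t.1 i j w) ≤ Valued.v (toPlace v w π) ^ a} =
      {t : S | ∀ i j (w : PlacesOver E v), Valued.v (t.1 i j w) ≤ Valued.v (toPlace v w π) ^ a} := by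
  ext t
  simp only [Set.mem_preimage, Set.mem_setOf_eq]
  constructor
  · intro h
    have h' := mball_mul F E v hπ (mball_mul F E v hπ hA' h) hD''
    rw [zero_add, add_zero, ← hL' (L t), ContinuousAddEquiv.symm_apply_apply] at h'
    exact h'
  · intro h
    have h' := mball_mul F E v hπ (mball_mul F E v hπ hA h) hD'
    rw [zero_add, add_zero, ← hL t] at h'
    exact h'

include hπ in
/-- **LEVI PRESERVATION OF THE SHELLS (= F4a's `hLSh`)**. [cite: HarrisKudlaSweet1996, §1 (1.12)] [cite: Casselman1980, §3] -/
theorem preimage_shell_eq_of_integral (L : S ≃ₜ+ S) {A D' A' D'' : Matrix (Fin n) (Fin n) (LocalRing E v)}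
    (hL : ∀ t : S, (L t).1 = A * t.1 * D') (hL' : ∀ t : S, (L.symm t).1 = A' * t.1 * D'')
    (hA : ∀ i j (w : PlacesOver E v), Valued.v (A i j w) ≤ Valued.v (toPlace v w π) ^ (0 : ℤ))
    (hD' : ∀ i j (w : PlacesOver E v), Valued.v (D' i j w) ≤ Valued.v (toPlace v w π) ^ (0 : ℤ))
    (hA' : ∀ i j (w : PlacesOver E v), Valued.v (A' i j w) ≤ Valued.v (toPlace v w π) ^ (0 : ℤ))
    (hD'' : ∀ i j (w : PlacesOver E v), Valued.v (D'' i j w) ≤ Valued.v (toPlace v w π) ^ (0 : ℤ)) (k : ℤ) :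
    L ⁻¹' ({t : S | ∀ i j (w : PlacesOver E v), Valued.v (t.1 i j w) ≤ Valued.v (toPlace v w π) ^ (-k)} \
        {t : S | ∀ i j (w : PlacesOver E v), Valued.v (t.1 i j w) ≤ Valued.v (toPlace v w π) ^ (-k + 1)}) =
      {t : S | ∀ i j (w : PlacesOver E v), Valued.v (t.1 i j w) ≤ Valued.v (toPlace v w π) ^ (-k)} \
        {t : S | ∀ i j (w : PlacesOver E v), Valued.v (t.1 i j w) ≤ Valued.v (toPlace v w π) ^ (-k + 1)} := by
  rw [Set.preimage_sdiff, preimage_ball_eq_of_integral F E v hπ n S L hL hL' hA hD' hA' hD'',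
    preimage_ball_eq_of_integral F E v hπ n S L hL hL' hA hD' hA' hD'']

end Levi

/-! ## §4 Regularity of the pulled-back section `t ↦ f(w_Δ n(t))` -/

section Regularity

/-- **right-invariance under an OPEN subgroup makes `f` locally constant, hence continuous** (smooth vectors). [cite: Casselman1980, §3] -/
theorem continuous_of_rightInvariant {G : Type*} [Group G] [TopologicalSpace G] [IsTopologicalGroup G] {X : Type*} [TopologicalSpace X]
    {f : G → X} {U : Subgroup G} (hU : IsOpen (U : Set G)) (hfU : ∀ g k, k ∈ U → f (g * k) = f g) : Continuous f := by
  refine (IsLocallyConstant.iff_eventually_eq f).2 (fun g => ?_) |>.continuous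
  have hmem : (fun k => g * k) '' (U : Set G) ∈ 𝓝 g := by
    refine ((Homeomorph.mulLeft g).isOpenMap _ hU).mem_nhds ?_
    exact ⟨1, U.one_mem, mul_one g⟩
  filter_upwards [hmem] with x hx
  obtain ⟨k, hk, rfl⟩ := hx
  exact hfU g k hk

include hJD in
/-- **the pulled-back section is continuous**: `t ↦ f(w_Δ · n(t))` on `S` for a continuous `f` (★ `continuous_nElem_skew`). [cite: Casselman1980, §3]
[cite: Weil1965, §37] -/
theorem continuous_pullback {X : Type*} [TopologicalSpace X] {f : UnitaryGroup.localPi E c (n + n) JD v → X} (hf : Continuous f) :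
    Continuous fun t : S => f (weylDelta F E c v n hJD (T₀ := T₀) * nElem F E c v n hJD t.1 ((hS t.1).1 t.2)) := by
  have h := (continuous_subtype_val.comp (continuous_nElem_skew F E c v n hJD S hS))
  exact hf.comp (continuous_const.mul h)

include hJD in
/-- **measurability of the pull-back (= F4a's `hφm`)**. [cite: Casselman1980, §3] -/
theorem measurable_pullback [MeasurableSpace S] [BorelSpace S] {X : Type*} [TopologicalSpace X] [MeasurableSpace X] [BorelSpace X]
    {f : UnitaryGroup.localPi E c (n + n) JD v → X} (hf : Continuous f) :
    Measurable fun t : S => f (weylDelta F E c v n hJD (T₀ := T₀) * nElem F E c v n hJD t.1 ((hS t.1).1 t.2)) :=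
  (continuous_pullback F E c v n hJD S hS hf).measurable

include hJD in
/-- **boundedness of the pull-back on a compact set** (e.g. a ball `B a`, `isCompact_ball`). [cite: Casselman1980, §3] -/
theorem exists_bound_pullback_of_isCompact {f : UnitaryGroup.localPi E c (n + n) JD v → ℂ} (hf : Continuous f) {K : Set S} (hK : IsCompact K) :
    ∃ C : ℝ, ∀ t ∈ K, ‖f (weylDelta F E c v n hJD (T₀ := T₀) * nElem F E c v n hJD t.1 ((hS t.1).1 t.2))‖ ≤ C :=
  hK.exists_bound_of_continuousOn (continuous_pullback F E c v n hJD S hS hf).continuousOn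

include hJD hπ in
/-- **boundedness of the pull-back on a shell (= F4a's `hφC`)**: the shell lies in the compact ball `B(−k)`. [cite: Casselman1980, §3] -/
theorem exists_bound_pullback_shell {f : UnitaryGroup.localPi E c (n + n) JD v → ℂ} (hf : Continuous f) (k : ℤ) :
    ∃ C : ℝ, ∀ t ∈ ({t : S | ∀ i j (w : PlacesOver E v), Valued.v (t.1 i j w) ≤ Valued.v (toPlace v w π) ^ (-k)} \
        {t : S | ∀ i j (w : PlacesOver E v), Valued.v (t.1 i j w) ≤ Valued.v (toPlace v w π) ^ (-k + 1)}),
      ‖f (weylDelta F E c v n hJD (T₀ := T₀) * nElem F E c v n hJD t.1 ((hS t.1).1 t.2))‖ ≤ C := by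
  obtain ⟨C, hC⟩ := exists_bound_pullback_of_isCompact F E c v n hJD S hS hf (isCompact_ball F E c v hπ n S hS (-k))
  exact ⟨C, fun t ht => hC t (Set.sdiff_subset ht)⟩

end Regularity

end Summit.HodgeConjecture.HodgeConjecture.Cruxes.HLiu418.K2LiuSkewLatticeShells

end
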